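import Summits.HodgeConjecture.HodgeConjecture.Theorems.VHCAbelianSchemesRoadSecantQuotientAnchorDefs
import Summits.HodgeConjecture.HodgeConjecture.Theorems.VHCAbelianSchemesRoadSecantAnchorMarkman
import Literature.AlgebraicGeometry.HodgeTheory.MotivatedClassesTransport
import Literature.AlgebraicGeometry.HodgeTheory.IsoTransport
import Literature.AlgebraicGeometry.Motives.CurveNet
import HarnessLib

/-!
# Secant–quotient anchors: TRANSPORT along isomorphisms and the SERVED-FIBRE-FROM-A-CHART lemma

research route conditional on HC_CM; not a corollary; Q11.4-sentence-2 already refuted in dim ≥ 3.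

Ring-2 road route `VHCAbelianSchemesRoad`, crux `SemiregularSheafRepresentativesTwAtDiag`, cell `(6, 3)`, skeleton v3
(`Cruxes/SemiregularSheafRepresentativesTwAtDiag/Lines/birth.lean`). This module is plate P2 of the LEAD's card v3: the
anchor predicate `IsSecantQuotientWeilClassAt` of `…SecantQuotientAnchorDefs` (a chart `e : X ≅ D.Y.X` of a secant quotient
plus conditions read through the chart) is TRANSPORTED along any isomorphism `e' : X' ≅ X` (`IsSecantQuotientWeilClassAt.of_iso`;
the chart composes, the `X`-side polarisation clause moves by `IsPolarizationClass.map_of_iso`, the off-ray clause by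
`map_not_mem_span_cupPowTwo_of_iso`, the `Y`-side clauses are chart-invariant by `(e' ≪≫ e)⁻¹ ∘ e'^* = e⁻¹`). Consequences:
the pair `(secantQuotientAnchors, secantQuotientServedClasses)` satisfies the transport hypothesis `htr` of
`…ServedFibreAnchors.exists_servedPencil_of_anchor` ∕ `not_forall_not_hasServedFibre_of_anchor` at `(n, p) = (6, 3)`
(`secantQuotient_transport`), and a pencil whose fibre at `sₐ` is a CHART of an anchored `(X, θ, w)` — with a global class `Θ`
restricting to `θ` there and `W` restricting to `w` — HAS A SERVED FIBRE (`hasServedFibre_secantQuotient_of_chart`): the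
form in which the first prover target P1 (a displayed pointed family through `Y_d` ⟹ a cell-shaped pencil with
`HasServedFibre 6 3 𝔄 𝔖 f W`) consumes the anchors. Nothing here asserts that any anchor exists or that any cell ∕ carrier ∕
residual statement holds; no statement of the route is touched.
-/

noncomputable section

set_option linter.dupNamespace false

open CategoryTheory AlgebraicGeometry Literature.AlgebraicGeometry Literature.AlgebraicGeometry.Motives
  Literature.AlgebraicGeometry.HodgeTheory Literature.AlgebraicGeometry.Markman2025

namespace Summit.HodgeConjecture.HodgeConjecture.Ring2.SemiregularRepresentatives

variable {X X' : SchemeOver ℂ} {θ : complexBetti X 2} {γ : complexBetti X (2 * 3)}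

namespace SecantQuotientDatum

/-- The secant quotient `D.Y` is a smooth projective sixfold. [cite: Markman2025SecantWeil, §1.5 (p. 7)] -/
theorem isSmoothProjective_Y (D : SecantQuotientDatum) : IsSmoothProjective 6 D.Y.X :=
  D.dim_Y ▸ AbelianVariety.isSmoothProjective_holds (A := D.Y)

end SecantQuotientDatum

namespace IsSecantQuotientWeilClassAt

/-- A variety carrying a secant–quotient Weil class is a smooth projective sixfold (it is a chart of `D.Y`).
[cite: Markman2025SecantWeil, §1.5 (p. 7)] -/
theorem isSmoothProjective (h : IsSecantQuotientWeilClassAt X θ γ) : IsSmoothProjective 6 X := by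
  obtain ⟨D, e, -⟩ := h
  exact D.isSmoothProjective_Y.of_iso e.symm

/-- The underlying variety is (a chart of) an abelian SIXFOLD — the shape of the hypothesis `hXab` of
`…ServedFibreAnchors.exists_servedPencil_of_anchor`. [cite: Markman2025SecantWeil, §1.5 (p. 7)] -/
theorem exists_abelianVariety (h : IsSecantQuotientWeilClassAt X θ γ) :
    ∃ A : AbelianVariety ℂ, A.dim = 6 ∧ Nonempty (A.X ≅ X) := by
  obtain ⟨D, e, -⟩ := h
  exact ⟨D.Y, D.dim_Y, ⟨e.symm⟩⟩

/-- **TRANSPORT along an isomorphism `e' : X' ≅ X`**: `e'^*γ` is a secant–quotient Weil class on `(X', e'^*θ)`. The chart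
composes (`e' ≪≫ e : X' ≅ D.Y.X`); the `Y`-side clauses are unchanged because `((e' ≪≫ e)⁻¹)^* (e'^* x) = (e⁻¹)^* x`; the
`X`-side polarisation clause is `IsPolarizationClass.map_of_iso`, rationality `IsRationalClass.map`, the off-ray clause
`map_not_mem_span_cupPowTwo_of_iso`. [cite: Andre1996Motifs, §1.1 (p. 10)] [cite: Markman2025SecantWeil, Thm. 1.4.1] -/
theorem of_iso (e' : X' ≅ X) (h : IsSecantQuotientWeilClassAt X θ γ) :
    IsSecantQuotientWeilClassAt X' (complexBetti.map e'.hom 2 θ) (complexBetti.map e'.hom (2 * 3) γ) := by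
  have hX : IsSmoothProjective 6 X := h.isSmoothProjective
  have hX' : IsSmoothProjective 6 X' := hX.of_iso e'.symm
  obtain ⟨D, e, hpol, hamp, hW, hγQ, hray, hmem⟩ := h
  have key : ∀ (k : ℕ) (x : complexBetti X k),
      complexBetti.map (e' ≪≫ e).inv k (complexBetti.map e'.hom k x) = complexBetti.map e.inv k x := by
    intro k x
    rw [Iso.trans_inv, complexBetti.map_comp, ModuleCat.comp_apply, e'.complexBetti_map_inv_map_hom]
  refine ⟨D, e' ≪≫ e, hpol.map_of_iso hX hX' e', ?_, ?_, hγQ.map _, map_not_mem_span_cupPowTwo_of_iso e' hray, ?_⟩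
  · rw [key]; exact hamp
  · rw [key]; exact hW
  · rw [key]; exact hmem

end IsSecantQuotientWeilClassAt

/-- Served classes transport: `w ∈ 𝔖 X θ ⟹ (e⁻¹)^* w ∈ 𝔖 X' ((e⁻¹)^* θ)` for `e : X ≅ X'` (the orientation of the hypothesis `htr`
of `…ServedFibreAnchors`). [cite: Markman2025SecantWeil, Thm. 1.4.1] -/
theorem secantQuotientServedClasses_transport (e : X ≅ X') {w : complexBetti X (2 * 3)}
    (hw : w ∈ secantQuotientServedClasses X θ) :
    complexBetti.map e.inv (2 * 3) w ∈ secantQuotientServedClasses X' (complexBetti.map e.inv 2 θ) :=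
  IsSecantQuotientWeilClassAt.of_iso e.symm hw

/-- Anchors transport: `𝔄 X θ ⟹ 𝔄 X' ((e⁻¹)^* θ)` for `e : X ≅ X'`. [cite: Markman2025SecantWeil, §1.5 (p. 7)] -/
theorem secantQuotientAnchors_transport (e : X ≅ X') (h : secantQuotientAnchors X θ) :
    secantQuotientAnchors X' (complexBetti.map e.inv 2 θ) := by
  obtain ⟨w, hw⟩ := h
  exact ⟨_, IsSecantQuotientWeilClassAt.of_iso e.symm hw⟩

/-- **The transport hypothesis `htr` of `…ServedFibreAnchors.exists_servedPencil_of_anchor` ∕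
`not_forall_not_hasServedFibre_of_anchor` HOLDS for the secant–quotient pair `(𝔄, 𝔖)` at `(n, p) = (6, 3)`** — verbatim shape.
[cite: Markman2025SecantWeil, §1.5 (p. 7) and Thm. 1.4.1] -/
theorem secantQuotient_transport :
    ∀ ⦃X X' : SchemeOver ℂ⦄ (e : X ≅ X') (θ : complexBetti X 2) (w : complexBetti X (2 * 3)),
      secantQuotientAnchors X θ → w ∈ secantQuotientServedClasses X θ →
        secantQuotientAnchors X' (complexBetti.map e.inv 2 θ) ∧
          complexBetti.map e.inv (2 * 3) w ∈ secantQuotientServedClasses X' (complexBetti.map e.inv 2 θ) :=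
  fun _ _ e _ _ h hw ↦ ⟨secantQuotientAnchors_transport e h, secantQuotientServedClasses_transport e hw⟩

/-- **SERVED FIBRE FROM A CHART (the form P1 consumes).** Let `f : 𝒳 → S` be any morphism, `W ∈ H⁶(𝒳)`, `Θ ∈ H²(𝒳)` a global
class whose restriction to every fibre is rational of type `(1,1)`, and `sₐ` a point whose fibre is a CHART `e : 𝒳_{sₐ} ≅ X` of a
polarised variety `(X, θ)` carrying a secant–quotient Weil class `w`, with `Θ|_{sₐ} = e^*θ` and `W|_{sₐ} = e^*w`. Then `f` has a
served fibre for `W` w.r.t. `(secantQuotientAnchors, secantQuotientServedClasses)`. Pure transport (`of_iso`); says nothing about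
the existence of such pencils. [cite: Markman2025SecantWeil, Thm. 1.4.1 and §1.5] [cite: Bloch1972Semiregularity, Remark (7.5)] -/
theorem hasServedFibre_secantQuotient_of_chart {𝒳 S : SchemeOver ℂ} {f : 𝒳 ⟶ S} {W : complexBetti 𝒳 (2 * 3)}
    (Θ : complexBetti 𝒳 2) (hΘQ : ∀ s : ComplexPoints S, IsRationalClass (complexBetti.map (fiberι f s) 2 Θ))
    (hΘH : ∀ s : ComplexPoints S, IsOfHodgeType 6 (fiberOver f s) 2 1 1 (complexBetti.map (fiberι f s) 2 Θ))
    (sₐ : ComplexPoints S) {X : SchemeOver ℂ} {θ : complexBetti X 2} {w : complexBetti X (2 * 3)}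
    (e : fiberOver f sₐ ≅ X) (hw : IsSecantQuotientWeilClassAt X θ w)
    (hΘ : complexBetti.map (fiberι f sₐ) 2 Θ = complexBetti.map e.hom 2 θ)
    (hW : complexBetti.map (fiberι f sₐ) (2 * 3) W = complexBetti.map e.hom (2 * 3) w) :
    HasServedFibre 6 3 (fun X θ ↦ secantQuotientAnchors X θ) (fun X θ ↦ secantQuotientServedClasses X θ) f W := by
  refine ⟨sₐ, Θ, hΘQ, hΘH, ?_, ?_⟩
  · rw [hΘ]; exact ⟨_, hw.of_iso e⟩
  · show complexBetti.map (fiberι f sₐ) (2 * 3) W ∈ secantQuotientServedClasses _ _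
    rw [hΘ, hW]; exact hw.of_iso e

/-- **Corollary (the anchor fibre is itself a chart of `Y_d`)**: same as `hasServedFibre_secantQuotient_of_chart` with the chart
valued in `D.Y.X` for a secant–quotient datum `D` and a class `w` served at `(D.Y.X, θ)`. [cite: Markman2025SecantWeil, §1.5 (p. 7)] -/
theorem hasServedFibre_secantQuotient_of_chart_Y {𝒳 S : SchemeOver ℂ} {f : 𝒳 ⟶ S} {W : complexBetti 𝒳 (2 * 3)}
    (Θ : complexBetti 𝒳 2) (hΘQ : ∀ s : ComplexPoints S, IsRationalClass (complexBetti.map (fiberι f s) 2 Θ))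
    (hΘH : ∀ s : ComplexPoints S, IsOfHodgeType 6 (fiberOver f s) 2 1 1 (complexBetti.map (fiberι f s) 2 Θ))
    (sₐ : ComplexPoints S) (D : SecantQuotientDatum) {θ : complexBetti D.Y.X 2} {w : complexBetti D.Y.X (2 * 3)}
    (e : fiberOver f sₐ ≅ D.Y.X) (hw : w ∈ secantQuotientServedClasses D.Y.X θ)
    (hΘ : complexBetti.map (fiberι f sₐ) 2 Θ = complexBetti.map e.hom 2 θ)
    (hW : complexBetti.map (fiberι f sₐ) (2 * 3) W = complexBetti.map e.hom (2 * 3) w) :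
    HasServedFibre 6 3 (fun X θ ↦ secantQuotientAnchors X θ) (fun X θ ↦ secantQuotientServedClasses X θ) f W :=
  hasServedFibre_secantQuotient_of_chart Θ hΘQ hΘH sₐ e hw hΘ hW

end Summit.HodgeConjecture.HodgeConjecture.Ring2.SemiregularRepresentatives

end
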